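import Summits.HodgeConjecture.CorCM.Census.OcticTwistReduction
import Summits.HodgeConjecture.CorCM.Census.QuarticTwistCount

/-!
# The octic twist `(ℤ/8 × B, (4,0))`, IV: ONE REDUCING FACE PER NON-RESIDUAL BLOCK COVERS (`|B| ≥ 3`)

COR-CM (cell `pub-hodgecm2`), count-neutral kernel combinatorics by the binder seat b09 (gen 33; lane COINVARIANT-TWIST / OCTIC RECON, design
step (a) of `HOME/pub-hodgecm2-b09/lean-g33/COINVARIANT-TWIST.md` PART C), on top of parts I–III (`Census/OcticTwist{Model,Motion,Reduction}.lean`: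
`Ty₂`, `tens`, `hodge₂`, motions `act`, `transl₂`, blocks `Orb₂`, the octic potential `pot` with `pot_act`, `Covers₂`, `exists_reduced₂`) and of
the quartic files (`Census/QuarticTwistSquares.lean`: `Phi`, `lee`, `flip`, `faceVec`; `Census/QuarticTwistReduction.lean`: `IsRes`, `atom`,
`L_atom_self`, `L_atom_other`; `Census/QuarticTwistCount.lean`: **`exists_goodSquare`**) used BY NAME.  Bookkeeping definitions with bodies
(`spanMot`, `IsFace₂`, `potOrb`) + theorems; no `decide`, no certificate, no named fact, no `sorry`.
HONEST FRAMING: `HC_CM` is NOT proved, here or anywhere in the tree; nothing here is a period or a headline.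

CONTENT (`B` any finite group with `|B| ≥ 3`; no parity hypothesis).
* §1 `spanMot S` — the span of ALL MOTIONS of a finite family `S` of exponent vectors — is stable under the motions (`transl₂_mem_spanMot`;
  motions compose, `exists_transl₂_comp`).
* §2 the Lee potential of an atom is `Lee k` for `|B| ≥ 3` (`Phi_atom`), flips of atoms in their own column (`flip_atom`), `lee = 2 ↔ k = 2`,
  `lee = 1 ↔ k = ±1`.
* §3 **through every pair type of octic potential `Φ₂ ≥ 2` there is an octic FACE `e_T − e_{T₁} − e_{T₂} + e_{T₃}` with three corners
  of smaller potential** (`exists_rel`): a coset cross square (quartic `exists_goodSquare`) or a coset COLUMN face (at a `2`-atom coordinate) in a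
  coordinate of potential `≥ 2` resp. at a non-residual or `2`-atom coordinate, and otherwise — both coordinates `±1`-atoms — the MIXED square
  `(e_a − e_u) ⊗ (e_{a′} − e_{u′})` with corners `(u, a′), (a, u′), (u, u′)`.
* §4 **THE COVERING FAMILY** (`exists_cover_family`): choosing one such relation at a representative of every block of potential `≥ 2`
  (`potOrb`, well defined by `pot_act`) gives a finite family `S` of octic RANK-FOUR FACES (`IsFace₂`: coset or mixed; `mem_hodge₂_of_isFace₂`) with **`|S| ≤ #{blocks with Φ₂ ≥ 2}`** whose motions cover:
  `Covers₂ (spanMot S)` — a motion carrying the representative to `T` carries the relation to one through `T` with the same potential drops.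
  With part III: **every octic exponent vector is congruent modulo the motions of `S` to one supported on `Φ₂ ≤ 1`**
  (`exists_family_reduced`).  What remains for `μ(ℤ/8 × B) = β − 1`: the residual module on `Φ₂ ≤ 1` (ten blocks, nine generators; lane note
  FACT 2–3) and the count, with the floor of `Census/CoinvariantTwistLaw.lean`.

## References
* [Pohlmann1968] H. Pohlmann, Algebraic cycles on abelian varieties of complex multiplication type, Ann. of Math. 88 (1968), Thm 1.
* [Milne1999] J. S. Milne, Lefschetz motives and the Tate conjecture, Compositio Math. 117 (1999), Prop. 2.1, p. 54.
-/

namespace Summit.HodgeConjecture.CorCM.Census.OcticTwist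

open Finset
open Summit.HodgeConjecture.CorCM.Census.QuarticTwist

variable (B : Type) [AddGroup B] [Fintype B] [DecidableEq B]

/-! ## §1 The span of all motions of a family -/

/-- **The span of all motions** of a finite family of octic exponent vectors. [folklore] -/
def spanMot (S : Finset (Ty₂ B → ℤ)) : Submodule ℤ (Ty₂ B → ℤ) :=
  Submodule.span ℤ {v | ∃ (e : Bool) (h : ZMod 4 × B), ∃ f ∈ S, v = transl₂ B e h f}

omit [Fintype B] [DecidableEq B] in
/-- Translation by the trivial motion is the identity. [folklore] -/
theorem transl₂_false_zero (v : Ty₂ B → ℤ) : transl₂ B false 0 v = v := by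
  funext T
  show v (act B false (-0) T) = v T
  rw [neg_zero, act_false, tw₂_zero]

omit [Fintype B] [DecidableEq B] in
/-- A member of the family lies in the span of its motions. [folklore] -/
theorem mem_spanMot_of_mem {S : Finset (Ty₂ B → ℤ)} {f : Ty₂ B → ℤ} (hf : f ∈ S) : f ∈ spanMot B S :=
  Submodule.subset_span ⟨false, 0, f, hf, (transl₂_false_zero B f).symm⟩

omit [Fintype B] [DecidableEq B] in
/-- A motion of a member of the family lies in the span. [folklore] -/
theorem transl₂_mem_spanMot_of_mem {S : Finset (Ty₂ B → ℤ)} {f : Ty₂ B → ℤ} (hf : f ∈ S) (e : Bool) (h : ZMod 4 × B) :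
    transl₂ B e h f ∈ spanMot B S :=
  Submodule.subset_span ⟨e, h, f, hf, rfl⟩

omit [Fintype B] [DecidableEq B] in
/-- **Motions compose**: `transl₂ e h ∘ transl₂ e' h'` is again a `transl₂`. [folklore] -/
theorem exists_transl₂_comp (e e' : Bool) (h h' : ZMod 4 × B) :
    ∃ (E : Bool) (H : ZMod 4 × B), ∀ v : Ty₂ B → ℤ, transl₂ B e h (transl₂ B e' h' v) = transl₂ B E H v := by
  -- the composite motion `act e h ∘ act e' h' = act E H`
  obtain ⟨E, H, hEH⟩ : ∃ (E : Bool) (H : ZMod 4 × B), ∀ T, act B e h (act B e' h' T) = act B E H T := by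
    cases e <;> cases e'
    · exact ⟨false, h + h', act_false_false B h h'⟩
    · exact ⟨true, h + h', act_false_true B h h'⟩
    · exact ⟨true, h + h', act_true_false B h h'⟩
    · exact ⟨false, h + h' + (1, 0), act_true_true B h h'⟩
  refine ⟨E, H, fun v => ?_⟩
  funext T
  show v (actInv B e' h' (actInv B e h T)) = v (actInv B E H T)
  congr 1
  apply (actEquiv B E H).injective
  show act B E H (actInv B e' h' (actInv B e h T)) = act B E H (actInv B E H T)
  rw [← hEH, act_actInv, act_actInv, act_actInv]

omit [Fintype B] [DecidableEq B] in
/-- **The span of all motions is stable under the motions.** [folklore] -/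
theorem transl₂_mem_spanMot {S : Finset (Ty₂ B → ℤ)} {v : Ty₂ B → ℤ} (hv : v ∈ spanMot B S) (e : Bool) (h : ZMod 4 × B) :
    transl₂ B e h v ∈ spanMot B S := by
  induction hv using Submodule.span_induction with
  | mem x hx =>
    obtain ⟨e', h', f, hf, rfl⟩ := hx
    obtain ⟨E, H, hEH⟩ := exists_transl₂_comp B e e' h h'
    rw [hEH]
    exact transl₂_mem_spanMot_of_mem B hf E H
  | zero => exact Submodule.zero_mem _
  | add x y _ _ hx hy =>
    rw [transl₂_add]
    exact Submodule.add_mem _ hx hy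
  | smul c x _ hx =>
    rw [transl₂_smul]
    exact Submodule.smul_mem _ c hx

/-- Vectors of a family of octic Hodge vectors span Hodge vectors, and so do their motions. [folklore] -/
theorem spanMot_le_hodge₂ {S : Finset (Ty₂ B → ℤ)} (hS : ∀ f ∈ S, f ∈ hodge₂ B) : spanMot B S ≤ hodge₂ B := by
  refine Submodule.span_le.mpr ?_
  rintro v ⟨e, h, f, hf, rfl⟩
  exact transl₂_mem_hodge₂ B (hS f hf) e h

/-! ## §2 Lee potentials of atoms -/

omit [AddGroup B] [Fintype B] [DecidableEq B] in
/-- `Lee k = 2 ↔ k = 2`. [folklore] -/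
theorem lee_eq_two_iff (k : ZMod 4) : lee k = 2 ↔ k = 2 := by
  unfold lee
  split_ifs with h0 h2
  · rw [h0]; decide
  · exact ⟨fun _ => h2, fun _ => rfl⟩
  · exact ⟨fun h => absurd h (by decide), fun h => absurd h h2⟩

omit [AddGroup B] [Fintype B] [DecidableEq B] in
/-- `Lee k = 1 ↔ k = ±1`. [folklore] -/
theorem lee_eq_one_iff (k : ZMod 4) : lee k = 1 ↔ k = 1 ∨ k = -1 := by
  unfold lee
  split_ifs with h0 h2
  · rw [h0]; decide
  · rw [h2]; decide
  · constructor
    · intro _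
      revert h0 h2
      revert k
      decide
    · intro _; rfl

omit [AddGroup B] in
/-- **The Lee potential of an atom is `Lee k`** (`|B| ≥ 3`): its own regime gives `Lee k ≤ 2`, every other regime at least `|B| − 1`.
[folklore] -/
theorem Phi_atom (h3 : 3 ≤ Fintype.card B) (u : ZMod 4) (b : B) (k : ZMod 4) : Phi B (atom B u b k) = lee k := by
  apply le_antisymm
  · rw [← L_atom_self B u b k]
    exact Phi_le B u _
  · obtain ⟨u', hu'⟩ := exists_L_eq_Phi B (atom B u b k)
    rw [← hu']
    by_cases huu : u' = u
    · rw [huu, L_atom_self]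
    · rw [L_atom_other]
      have h1 : 1 ≤ lee (u - u') := by
        have := (lee_eq_zero_iff (u - u')).not.mpr (sub_ne_zero.mpr (Ne.symm huu))
        omega
      have h2 : 2 * 1 ≤ (Fintype.card B - 1) * lee (u - u') := Nat.mul_le_mul (by omega) h1
      have := lee_le_two k
      omega

omit [AddGroup B] in
/-- The potential of a constant type is `0` (`|B| ≥ 3`). [folklore] -/
theorem Phi_cst (h3 : 3 ≤ Fintype.card B) (u : ZMod 4) (b : B) : Phi B (cst B u) = 0 := by
  rw [← atom_zero B u b, Phi_atom B h3]
  rfl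

omit [AddGroup B] [Fintype B] in
/-- Adding a unit vector in the atomʼs own column moves the atom: `(u + kδ_b) + eδ_b = u + (k+e)δ_b`. [folklore] -/
theorem atom_add_single (u : ZMod 4) (b : B) (k e : ZMod 4) : atom B u b k + Pi.single b e = atom B u b (k + e) := by
  unfold atom
  rw [add_assoc, ← Pi.single_add]

omit [AddGroup B] [Fintype B] in
/-- **A flip of an atom in its own column is an atom**: `(u + kδ_b)^{(j,b)} = u + (k + step)δ_b`. [folklore] -/
theorem flip_atom (j : ZMod 2) (u : ZMod 4) (b : B) (k : ZMod 4) :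
    QuarticTwist.flip B (j, b) (atom B u b k) = atom B u b (k + step j (u + k)) := by
  rw [flip_eq_add_single]
  show atom B u b k + Pi.single b (step j (atom B u b k b)) = _
  rw [atom_apply, if_pos rfl, atom_add_single]

omit [AddGroup B] in
/-- The corners of the column face at a `2`-atom have potential `< 2` (`|B| ≥ 3`). [folklore] -/
theorem Phi_flip_two_atom_lt (h3 : 3 ≤ Fintype.card B) (j : ZMod 2) (u : ZMod 4) (b : B) :
    Phi B (QuarticTwist.flip B (j, b) (atom B u b 2)) < 2 := by
  rw [flip_atom, Phi_atom B h3]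
  rcases step_eq_or j (u + 2) with h | h
  · rw [h]; decide
  · rw [h]; decide

omit [AddGroup B] in
/-- The double corner of the column face at a `2`-atom is the constant type (potential `0`). [folklore] -/
theorem Phi_flip_flip_two_atom (h3 : 3 ≤ Fintype.card B) (u : ZMod 4) (b : B) :
    Phi B (QuarticTwist.flip B (1, b) (QuarticTwist.flip B (0, b) (atom B u b 2))) = 0 := by
  rw [show ((1 : ZMod 2), b) = ((0 : ZMod 2) + 1, b) by rw [zero_add], flip_flip_same, atom_add_single, Phi_atom B h3]
  decide

omit [AddGroup B] [Fintype B] in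
/-- **A `±1`-atom is one flip away from its constant**: `cst u = (u + kδ_b)^{(j,b)}` for the place `j` with `step j (u+k) = −k`. [folklore] -/
theorem exists_flip_atom_eq_cst (u : ZMod 4) (b : B) {k : ZMod 4} (hk : k = 1 ∨ k = -1) :
    ∃ j : ZMod 2, QuarticTwist.flip B (j, b) (atom B u b k) = cst B u := by
  have hk' : -k = 1 ∨ -k = -1 := by
    rcases hk with rfl | rfl
    · exact Or.inr rfl
    · exact Or.inl (neg_neg 1)
  obtain ⟨j, hj⟩ := exists_place (u + k) (-k) hk'
  refine ⟨j, ?_⟩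
  rw [flip_atom, hj, add_neg_cancel, atom_zero]

/-- **The octic rank-four faces** as exponent vectors: a quartic face in coordinate `0` or `1` (the other coordinate passive), or a MIXED
face (one flip in each coordinate). [folklore] -/
def IsFace₂ (F : Ty₂ B → ℤ) : Prop :=
  (∃ (s t : Ty B) (p q : ZMod 2 × B), p ≠ q ∧ F = tens B (faceVec B s p q) (Pi.single t 1)) ∨
  (∃ (s t : Ty B) (p q : ZMod 2 × B), p ≠ q ∧ F = tens B (Pi.single s 1) (faceVec B t p q)) ∨
  (∃ (s t : Ty B) (p q : ZMod 2 × B),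
    F = tens B (Pi.single s 1 - Pi.single (QuarticTwist.flip B p s) 1) (Pi.single t 1 - Pi.single (QuarticTwist.flip B q t) 1))

omit [AddGroup B] in
/-- **Octic faces are octic Hodge vectors.** [folklore] -/
theorem mem_hodge₂_of_isFace₂ {F : Ty₂ B → ℤ} (hF : IsFace₂ B F) : F ∈ hodge₂ B := by
  rcases hF with ⟨s, t, p, q, hpq, rfl⟩ | ⟨s, t, p, q, hpq, rfl⟩ | ⟨s, t, p, q, rfl⟩
  · exact cface₀_mem_hodge₂ B s hpq t
  · exact cface₁_mem_hodge₂ B s t hpq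
  · exact mface_mem_hodge₂ B s t p q

/-! ## §3 A reducing relation through every pair type of potential `≥ 2` -/

omit [AddGroup B] in
/-- **A quartic reducing face**: through a non-residual type, or a `2`-atom, there is a rank-four face `(s; p, q)` (`p ≠ q`) whose three other
corners have smaller Lee potential (`|B| ≥ 3`; cross square resp. column face). [folklore] -/
theorem exists_quartic_rel (h3 : 3 ≤ Fintype.card B) {s : Ty B} (hs : ¬ IsRes B s ∨ ∃ (u : ZMod 4) (b : B), s = atom B u b 2) :
    ∃ p q : ZMod 2 × B, p ≠ q ∧ Phi B (QuarticTwist.flip B p s) < Phi B s ∧ Phi B (QuarticTwist.flip B q s) < Phi B s ∧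
      Phi B (QuarticTwist.flip B q (QuarticTwist.flip B p s)) < Phi B s := by
  rcases hs with hs | ⟨u, b, rfl⟩
  · obtain ⟨p, q, hpq, h1, h2, h3'⟩ := exists_goodSquare B h3 hs
    exact ⟨p, q, fun h => hpq (by rw [h]), h1, h2, h3'⟩
  · refine ⟨(0, b), (1, b), fun h => zero_ne_one ((Prod.ext_iff.mp h).1 : (0 : ZMod 2) = 1), ?_, ?_, ?_⟩
    · rw [Phi_atom B h3]
      exact Phi_flip_two_atom_lt B h3 0 u b
    · rw [Phi_atom B h3]
      exact Phi_flip_two_atom_lt B h3 1 u b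
    · rw [Phi_atom B h3, Phi_flip_flip_two_atom B h3]
      decide

omit [AddGroup B] in
/-- A residual type that is not a `2`-atom has potential `≤ 1` (`|B| ≥ 3`). [folklore] -/
theorem Phi_le_one_of_isRes (h3 : 3 ≤ Fintype.card B) {s : Ty B} (hs : IsRes B s) (h2 : ¬ ∃ (u : ZMod 4) (b : B), s = atom B u b 2) :
    Phi B s ≤ 1 := by
  obtain ⟨u, b, k, rfl⟩ := hs
  rw [Phi_atom B h3]
  have hk : k ≠ 2 := fun h => h2 ⟨u, b, by rw [h]⟩
  have := lee_le_two k
  have := (lee_eq_two_iff k).not.mpr hk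
  omega

omit [AddGroup B] in
/-- A residual type of potential `1` is a `±1`-atom (`|B| ≥ 3`). [folklore] -/
theorem exists_atom_of_Phi_eq_one (h3 : 3 ≤ Fintype.card B) {s : Ty B} (hs : IsRes B s) (h1 : Phi B s = 1) :
    ∃ (u : ZMod 4) (b : B) (k : ZMod 4), (k = 1 ∨ k = -1) ∧ s = atom B u b k := by
  obtain ⟨u, b, k, rfl⟩ := hs
  rw [Phi_atom B h3, lee_eq_one_iff] at h1
  exact ⟨u, b, k, h1, rfl⟩

omit [AddGroup B] in
/-- **THROUGH EVERY PAIR TYPE OF OCTIC POTENTIAL `≥ 2` THERE IS A REDUCING OCTIC HODGE RELATION** (`|B| ≥ 3`): a coset face in a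
coordinate that is non-residual or a `2`-atom, else (both coordinates `±1`-atoms) the mixed square. [folklore] -/
theorem exists_rel (h3 : 3 ≤ Fintype.card B) (T : Ty₂ B) (hT : 2 ≤ pot B T) :
    ∃ T₁ T₂ T₃ : Ty₂ B, IsFace₂ B (Pi.single T 1 - Pi.single T₁ 1 - Pi.single T₂ 1 + Pi.single T₃ 1 : Ty₂ B → ℤ) ∧
      pot B T₁ < pot B T ∧ pot B T₂ < pot B T ∧ pot B T₃ < pot B T := by
  obtain ⟨s, t⟩ := T
  simp only [pot_mk] at hT ⊢
  by_cases hs : ¬ IsRes B s ∨ ∃ (u : ZMod 4) (b : B), s = atom B u b 2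
  · -- coset face in coordinate 0
    obtain ⟨p, q, hpq, h1, h2, h12⟩ := exists_quartic_rel B h3 hs
    refine ⟨(QuarticTwist.flip B p s, t), (QuarticTwist.flip B q s, t), (QuarticTwist.flip B q (QuarticTwist.flip B p s), t), ?_,
      by rw [pot_mk]; omega, by rw [pot_mk]; omega, by rw [pot_mk]; omega⟩
    exact Or.inl ⟨s, t, p, q, hpq, (cface₀_eq B s t p q).symm⟩
  by_cases ht : ¬ IsRes B t ∨ ∃ (u : ZMod 4) (b : B), t = atom B u b 2
  · -- coset face in coordinate 1
    obtain ⟨p, q, hpq, h1, h2, h12⟩ := exists_quartic_rel B h3 ht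
    refine ⟨(s, QuarticTwist.flip B p t), (s, QuarticTwist.flip B q t), (s, QuarticTwist.flip B q (QuarticTwist.flip B p t)), ?_,
      by rw [pot_mk]; omega, by rw [pot_mk]; omega, by rw [pot_mk]; omega⟩
    exact Or.inr (Or.inl ⟨s, t, p, q, hpq, (cface₁_eq B s t p q).symm⟩)
  -- both coordinates residual and not 2-atoms: potentials ≤ 1, hence both = 1: two ±1-atoms, the mixed square
  rw [not_or, not_not] at hs ht
  have hs1 := Phi_le_one_of_isRes B h3 hs.1 hs.2
  have ht1 := Phi_le_one_of_isRes B h3 ht.1 ht.2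
  obtain ⟨u, b, k, hk, rfl⟩ := exists_atom_of_Phi_eq_one B h3 hs.1 (by omega)
  obtain ⟨u', b', k', hk', rfl⟩ := exists_atom_of_Phi_eq_one B h3 ht.1 (by omega)
  refine ⟨(cst B u, atom B u' b' k'), (atom B u b k, cst B u'), (cst B u, cst B u'), ?_, ?_, ?_, ?_⟩
  · obtain ⟨j, hj⟩ := exists_flip_atom_eq_cst B u b hk
    obtain ⟨j', hj'⟩ := exists_flip_atom_eq_cst B u' b' hk'
    refine Or.inr (Or.inr ⟨atom B u b k, atom B u' b' k', (j, b), (j', b'), ?_⟩)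
    rw [hj, hj', tens_sub_sub, single_eq_tens, single_eq_tens, single_eq_tens, single_eq_tens]
  · rw [pot_mk, Phi_cst B h3 u b]; omega
  · rw [pot_mk, Phi_cst B h3 u' b']; omega
  · rw [pot_mk, Phi_cst B h3 u b, Phi_cst B h3 u' b']; omega

/-! ## §4 The covering family: one relation per block of potential `≥ 2` -/

/-- **The octic potential of a block** (well defined by `pot_act`). [folklore] -/
def potOrb : Orb₂ B → ℕ :=
  Quotient.lift (pot B) (by
    rintro T T' ⟨e, h, rfl⟩
    exact (pot_act B e h T).symm)

omit [DecidableEq B] in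
/-- `potOrb ⟦T⟧ = pot T`. [folklore] -/
theorem potOrb_mk (T : Ty₂ B) : potOrb B (Quotient.mk (orbitRel₂ B) T) = pot B T := rfl

omit [DecidableEq B] in
/-- A motion carries a four-corner relation to the four-corner relation of the moved corners. [folklore] -/
theorem transl₂_rel (e : Bool) (h : ZMod 4 × B) (T T₁ T₂ T₃ : Ty₂ B) :
    transl₂ B e h (Pi.single T 1 - Pi.single T₁ 1 - Pi.single T₂ 1 + Pi.single T₃ 1) =
      Pi.single (act B e h T) 1 - Pi.single (act B e h T₁) 1 - Pi.single (act B e h T₂) 1 + Pi.single (act B e h T₃) 1 := by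
  rw [transl₂_add, transl₂_sub, transl₂_sub, transl₂_single, transl₂_single, transl₂_single, transl₂_single]

/-- **THE COVERING FAMILY** (`|B| ≥ 3`): a finite family `S` of octic Hodge vectors, at most one per block of potential `≥ 2`, whose motions
cover in the sense of `Covers₂`. [folklore] -/
theorem exists_cover_family (h3 : 3 ≤ Fintype.card B) :
    ∃ S : Finset (Ty₂ B → ℤ), (∀ f ∈ S, IsFace₂ B f) ∧
      S.card ≤ Fintype.card {ω : Orb₂ B // 2 ≤ potOrb B ω} ∧ Covers₂ B (spanMot B S) := by
  classical
  -- one relation per block of potential ≥ 2, at the representative `ω.out`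
  have hrep : ∀ ω : {ω : Orb₂ B // 2 ≤ potOrb B ω}, 2 ≤ pot B ω.1.out := by
    intro ω
    have h := ω.2
    rw [← Quotient.out_eq ω.1, potOrb_mk] at h
    exact h
  choose T₁ T₂ T₃ hH hP₁ hP₂ hP₃ using fun ω : {ω : Orb₂ B // 2 ≤ potOrb B ω} => exists_rel B h3 ω.1.out (hrep ω)
  let F : {ω : Orb₂ B // 2 ≤ potOrb B ω} → (Ty₂ B → ℤ) := fun ω =>
    Pi.single ω.1.out 1 - Pi.single (T₁ ω) 1 - Pi.single (T₂ ω) 1 + Pi.single (T₃ ω) 1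
  refine ⟨Finset.univ.image F, ?_, Finset.card_image_le.trans (by rw [Finset.card_univ]), ?_⟩
  · intro f hf
    obtain ⟨ω, _, rfl⟩ := Finset.mem_image.mp hf
    exact hH ω
  · intro T hT
    -- the block of `T` and a motion from its representative to `T`
    let ω : {ω : Orb₂ B // 2 ≤ potOrb B ω} := ⟨Quotient.mk (orbitRel₂ B) T, by rw [potOrb_mk]; exact hT⟩
    have hrel : (orbitRel₂ B).r ω.1.out T := Quotient.exact (Quotient.out_eq _)
    obtain ⟨e, h, hmove⟩ := hrel
    have hpot : pot B ω.1.out = pot B T := by rw [← hmove, pot_act]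
    refine ⟨act B e h (T₁ ω), act B e h (T₂ ω), act B e h (T₃ ω), ?_, ?_, ?_, ?_⟩
    · have hmem : transl₂ B e h (F ω) ∈ spanMot B (Finset.univ.image F) :=
        transl₂_mem_spanMot_of_mem B (Finset.mem_image_of_mem F (Finset.mem_univ ω)) e h
      rw [transl₂_rel, hmove] at hmem
      exact hmem
    · rw [pot_act, ← hpot]; exact hP₁ ω
    · rw [pot_act, ← hpot]; exact hP₂ ω
    · rw [pot_act, ← hpot]; exact hP₃ ω

/-- **ONE FACE PER NON-RESIDUAL BLOCK REDUCES EVERYTHING TO THE RESIDUAL PAIR TYPES** (`|B| ≥ 3`): there is a finite family `S` of octic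
Hodge vectors, at most one per block of potential `≥ 2`, such that every octic exponent vector is congruent modulo `P ⊔ spanMot S` — for any
submodule `P` (the octic pairs in the application) — to one supported on the pair types of potential `≤ 1`. [folklore] -/
theorem exists_family_reduced (h3 : 3 ≤ Fintype.card B) :
    ∃ S : Finset (Ty₂ B → ℤ), (∀ f ∈ S, IsFace₂ B f) ∧ S.card ≤ Fintype.card {ω : Orb₂ B // 2 ≤ potOrb B ω} ∧
      ∀ (P : Submodule ℤ (Ty₂ B → ℤ)) (m : Ty₂ B → ℤ),
        ∃ r : Ty₂ B → ℤ, m - r ∈ P ⊔ spanMot B S ∧ ∀ T, r T ≠ 0 → pot B T ≤ 1 := by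
  obtain ⟨S, hS, hcard, hcov⟩ := exists_cover_family B h3
  exact ⟨S, hS, hcard, fun P m => exists_reduced₂ B (covers₂_mono B le_sup_right hcov) m⟩

end Summit.HodgeConjecture.CorCM.Census.OcticTwist
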